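import Literature.MathematicalPhysics.QuantumFieldTheory.Balaban1983to89.B6Ineq2122CentredTorus
import Literature.MathematicalPhysics.QuantumFieldTheory.Balaban1983to89.B6Ineq2147TwoScaleV1Upper

/-!
# `Balaban1983to89.B6Ineq2122TwoScaleV1` — T. Bałaban, *Propagators and renormalization transformations for lattice gauge
# theories. II*, Commun. Math. Phys. **96** (1984) 223–250 [Balaban1984PropagatorsII], pp. 244, 246, 248: the lower bound of (2.122) on
# (2.121) FOR THE CONCRETE TWO-SCALE DATA `tsV1` — the displayed hypothesis `h2122` of gen 10 DISCHARGED — whence (2.120) is bounded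
# from below on the axial subspace, the covariance `C̃^{(j)}_Λ` is bounded from above (p. 246), and p. 248 *"Of course we have also a
# similar bound from above"* for (2.147) holds for `tsV1` WITH NO DISPLAYED HYPOTHESIS

statement-level skeleton of published theorems with citation tags; proofs where landed; nothing here is a claim about the Yang–Mills mass gap

PDF held: `paper:balaban1984-cmp96-propagators-rt-ii` (journal page = PDF page + 222; pp. 244, 246, 248 [PDF 22, 24, 26] read AS IMAGES on the ×4
renders `run/shared/lean/pub/pub-balaban/b2b-balaban-ref1/pages/1984-cmp96-propagators-rt-II/…-p022/p024/p026-x4.png`, 2026-08-21).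

PRINT (verbatim).  p. 244: *"We will prove that it is bounded from below by γ₀″‖B‖² on the configurations B satisfying (2.121)."*  p. 246:
*"These forms are bounded from below by γ₀″‖B‖² with a positive constant γ₀″ dependent on d and L only. This implies that a covariance
C̃^{(j)}_Λ of the Gaussian integral in (2.119) is bounded from above by a positive constant dependent on d and L only, and it has an
exponential decay with a decay rate having the same property."*  p. 248: *"⟨B, (QG^ξ_□Q*)↾_□B⟩ ≧ γ₀‖B‖² (2.147) with a positive constant γ₀
depending on d and L only. Of course we have also a similar bound from above and an exponential decay of a kernel of the operator in (2.147)."*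

CITATION HEADER (lean-in-tree rule) — WHAT IS REPRODUCED.  Phase-2 file of the `lit-balaban` typed skeleton (HOME
`run/shared/lean/pub/lit-balaban/`), seat **p22 gen 11** (B6 fold owner r03, referee ref-4; lane = the Sect. C chain (2.95)–(2.147) on the
concrete two-scale data `tsV1`).  SKELETON rows **B6.Eq2.120 / B6.Txt@246 / B6.Eq2.144**.  IMPORTS BY NAME `…B6Ineq2122CentredTorus.ineq2122_fn`
(same seat: the p. 244/246 claim on the torus, centred trees) and gen 10's `…B6Ineq2147TwoScaleV1Upper.inner_Sb_ge_V1_of_2122` /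
`inner_Ct_le_of_Sb_ge` / `ineq2147_V1_upper_of_2122`, whose displayed hypothesis `h2122` is discharged here.  THIS FILE:
* **`ineq2122_V1`**: `γ_P‖B‖² ≤ Σ_{o∈Λ^c}|B(o)|² + Σ_{e∈Λ′}|(Q₁B)(e)|² + Σ_p|(∂₁B)(p)|²` on the axial subspace `axial P j Λ′` of the V1 carrier,
  `γ_P = (481d⁶L^{2d+4})⁻¹` — EXACTLY the displayed `h2122` of gen 10;
* `inner_Sb_ge_out_V1` (p. 244 *"bounded from below by ‖B↾_{Λ^c}‖²"*, every `B`); **`inner_Sb_ge_V1`**: (2.120) `⟨B, (Q″*aQ″ + Δ_j)B⟩ ≥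
  min(w₀, κ)γ_P‖B‖²` on `Ax` for `tsV1` (weights `w ≥ w₀ > 0`, `κ = c²/(η^dL^{2j})`);
* **`inner_Ct_le_V1`**: p. 246, `⟨v, C̃^{(j)}_Λv⟩ ≤ (min(w₀, κ)γ_P)⁻¹‖P_{Ax}v‖²`;
* **`ineq2147_V1_upper`**: p. 248 *"a similar bound from above"*, `⟨x, QGQ*x⟩ ≤ (min(w₀, κ)γ_P)⁻¹(1 + L^{−d})‖x‖²` for `tsV1` — with gen 10's
  `…B6Ineq2147TwoScaleV1B1.ineq2147_V1` ((2.147) itself) the sentence is now two-sided for the concrete model, NO displayed hypothesis.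
THEOREMS ONLY (no definition, no `def … : Prop` fact); standard axioms.  HONEST SCOPE: CONSTANTS OURS (`γ_P⁻¹ = 481d⁶L^{2d+4}`; print: *"dependent
on d and L only"* — which is what is proved, uniformly in the volume and `Λ′`; the weights `w₀` and `κ` enter as displayed); the *"exponential
decay"* clauses of pp. 246/248 are NOT addressed; finite tori of the V1 calculus, centred blocks (`L` odd); NOT summit progress.
-/

noncomputable section

open scoped InnerProductSpace BigOperators

namespace Literature.MathematicalPhysics.QuantumFieldTheory.Balaban1983to89.B6Ineq2122TwoScaleV1

open LatticeFieldCalculus B6SectCTwoScaleV1 B6Ineq2122CentredTorus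

variable {P : Params} {j : ℕ}

/-! ## §1  The displayed hypothesis `h2122` on the V1 carrier -/

section Claim

variable (hj : j + 1 ≤ P.m + P.K) (Λ' : Finset (Site P (j + 1)))

include hj in
/-- **the displayed hypothesis `h2122` of gen 10 — PROVED**: on the axial subspace (2.121) of the V1 two-scale carrier,
`γ_P‖B‖² ≤ Σ_{o∈Λ^c}|B(o)|² + Σ_{e∈Λ′}|(Q₁B)(e)|² + Σ_p|(∂₁B)(p)|²` with `γ_P = (481d⁶L^{2d+4})⁻¹`, depending on `d` and `L` only.
[cite: Balaban1984PropagatorsII, (2.122) p.244] -/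
theorem ineq2122_V1 (B : UBond P j) (hB : B ∈ axial P j Λ') :
    (481 * (P.d : ℝ) ^ 6 * (P.L : ℝ) ^ (2 * P.d + 4))⁻¹ * ‖B‖ ^ 2 ≤
      ∑ o : OutBond j Λ', B o.1 ^ 2 + ∑ e : InBond j Λ', bondAvg (WithLp.ofLp B) e.1 ^ 2 +
        ∑ p : Plaq P j, curl 1 (WithLp.ofLp B) p ^ 2 := by
  classical
  have hΓ : 0 < 481 * (P.d : ℝ) ^ 6 * (P.L : ℝ) ^ (2 * P.d + 4) := by
    have : (0 : ℝ) < P.d := by exact_mod_cast P.hd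
    have : (0 : ℝ) < P.L := by exact_mod_cast P.L_pos
    positivity
  have h := ineq2122_fn hj Λ' (WithLp.ofLp B) ((mem_axial j Λ' B).1 hB)
  have e0 : ‖B‖ ^ 2 = ∑ b : PBond P j, (WithLp.ofLp B) b ^ 2 := by
    rw [EuclideanSpace.real_norm_sq_eq]
  have e1 : ∑ b ∈ Finset.univ.filter (fun b : PBond P j => blockOf b.src ∉ Λ' ∧ blockOf b.tgt ∉ Λ'), (WithLp.ofLp B) b ^ 2 =
      ∑ o : OutBond j Λ', B o.1 ^ 2 :=
    Finset.sum_subtype _ (fun b => by simp) (fun b => (WithLp.ofLp B) b ^ 2)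
  have e2 : ∑ c ∈ Finset.univ.filter (fun c : PBond P (j + 1) => c.src ∈ Λ' ∨ c.tgt ∈ Λ'), bondAvg (WithLp.ofLp B) c ^ 2 =
      ∑ e : InBond j Λ', bondAvg (WithLp.ofLp B) e.1 ^ 2 :=
    Finset.sum_subtype _ (fun c => by simp) (fun c => bondAvg (WithLp.ofLp B) c ^ 2)
  rw [e0, ← e1, ← e2, inv_mul_le_iff₀ hΓ]
  exact h

end Claim

/-! ## §2  Consequences for `tsV1`: (2.120) bounded from below on the axial subspace, `C̃` bounded from above, and p. 248 *"a similar bound from above"* -/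

section TwoScale

open B6SectCOperators B6SectCOperators.TwoScaleData B6SectCTwoScaleV1Lattice
open B5SectBStatements (eta)
open B6Ineq2147TwoScaleV1Upper (inner_Sb_ge_V1_of_2122 ineq2147_V1_upper_of_2122 inner_Ct_le_of_Sb_ge inner_Sb_split inner_Qpp_a_ge)

variable {c : ℝ} (hc : c ≠ 0) (hj : j + 1 ≤ P.m + P.K) (Λ' : Finset (Site P (j + 1))) {w : CIdx j Λ' → ℝ} (hw : ∀ i, 0 < w i) {w₀ : ℝ}

include hj hw in
/-- p. 244 *"The form is … bounded from below by ‖B↾_{Λ^c}‖²"* FOR `tsV1`: for weights `w ≥ w₀ ≥ 0` and EVERY `B` (no gauge condition),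
`⟨B, (Q″*aQ″ + Δ_j)B⟩ ≥ w₀ Σ_{o∈Λ^c}|B(o)|²` (the `Λ^c`-part of `⟨Q″B, aQ″B⟩`; `⟨B, Δ_jB⟩ ≥ 0` by (2.118)). [cite: Balaban1984PropagatorsII, (2.120)–(2.121) p.244] -/
theorem inner_Sb_ge_out_V1 (hw₀ : 0 ≤ w₀) (hw0 : ∀ i, w₀ ≤ w i) (b : UBond P j) :
    w₀ * ∑ o : OutBond j Λ', b o.1 ^ 2 ≤ ⟪b, (tsV1 hc Λ' w).Sb b⟫_ℝ := by
  have h1 := inner_Qpp_a_ge Λ' hw0 b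
  have h2 := (B6Ineq2118TwoScaleV1Plaq.ineq2118_V1_plaq hc hj Λ' hw (WithLp.ofLp b)).1
  rw [WithLp.toLp_ofLp] at h2
  have hκ0 : 0 ≤ c ^ 2 / (eta P.L j ^ P.d * ((P.L : ℝ) ^ j) ^ 2) * ∑ p : Plaq P j, curl 1 (WithLp.ofLp b) p ^ 2 :=
    mul_nonneg (B6Ineq2118TwoScaleV1.kappa_pos (P := P) hc (j := j)).le (Finset.sum_nonneg fun _ _ => sq_nonneg _)
  have h3 : 0 ≤ w₀ * ∑ e : InBond j Λ', bondAvg (WithLp.ofLp b) e.1 ^ 2 := mul_nonneg hw₀ (Finset.sum_nonneg fun _ _ => sq_nonneg _)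
  rw [inner_Sb_split hc Λ' b]
  rw [mul_add] at h1
  linarith

include hj hw in
/-- **(2.120) is bounded from below on the axial configurations of `tsV1`, NO displayed hypothesis**: for weights `w ≥ w₀ > 0`,
`⟨B, (Q″*aQ″ + Δ_j)B⟩ ≥ min(w₀, κ)·(481d⁶L^{2d+4})⁻¹‖B‖²` on `Ax`, `κ = c²/(η^dL^{2j})`. [cite: Balaban1984PropagatorsII, (2.120)–(2.122) p.244] -/
theorem inner_Sb_ge_V1 (hw₀ : 0 < w₀) (hw0 : ∀ i, w₀ ≤ w i) (m : ↥(tsV1 hc Λ' w).Ax) :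
    min w₀ (c ^ 2 / (eta P.L j ^ P.d * ((P.L : ℝ) ^ j) ^ 2)) * (481 * (P.d : ℝ) ^ 6 * (P.L : ℝ) ^ (2 * P.d + 4))⁻¹ * ‖(m : UBond P j)‖ ^ 2 ≤
      ⟪(m : UBond P j), (tsV1 hc Λ' w).Sb m⟫_ℝ :=
  inner_Sb_ge_V1_of_2122 hc hj Λ' hw hw₀ hw0 (fun B hB => ineq2122_V1 hj Λ' B hB) m

include hj hw in
/-- **p. 246 *"This implies that a covariance C̃^{(j)}_Λ of the Gaussian integral in (2.119) is bounded from above by a positive constant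
dependent on d and L only"* FOR `tsV1`, UNCONDITIONAL** (given the weights and `κ`): `⟨v, C̃^{(j)}_Λv⟩ ≤ (min(w₀, κ)·(481d⁶L^{2d+4})⁻¹)⁻¹‖P_{Ax}v‖²`.
[cite: Balaban1984PropagatorsII, p.246 (text after (2.128))] -/
theorem inner_Ct_le_V1 (hw₀ : 0 < w₀) (hw0 : ∀ i, w₀ ≤ w i) (v : UBond P j) :
    ⟪v, (tsV1 hc Λ' w).Ct v⟫_ℝ ≤
      (min w₀ (c ^ 2 / (eta P.L j ^ P.d * ((P.L : ℝ) ^ j) ^ 2)) * (481 * (P.d : ℝ) ^ 6 * (P.L : ℝ) ^ (2 * P.d + 4))⁻¹)⁻¹ *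
        ‖(tsV1 hc Λ' w).Ax.starProjection v‖ ^ 2 := by
  have hκ0 : 0 < c ^ 2 / (eta P.L j ^ P.d * ((P.L : ℝ) ^ j) ^ 2) := B6Ineq2118TwoScaleV1.kappa_pos (P := P) hc (j := j)
  have hΓ : 0 < (481 * (P.d : ℝ) ^ 6 * (P.L : ℝ) ^ (2 * P.d + 4))⁻¹ := by
    have : (0 : ℝ) < P.d := by exact_mod_cast P.hd
    have : (0 : ℝ) < P.L := by exact_mod_cast P.L_pos
    positivity
  exact inner_Ct_le_of_Sb_ge (isLattice Λ' hc hj hw) (positive Λ' hc hj w) (mul_pos (lt_min hw₀ hκ0) hΓ)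
    (inner_Sb_ge_V1 hc hj Λ' hw hw₀ hw0) v

include hj hw in
/-- **p. 248 *"Of course we have also a similar bound from above"* FOR `tsV1`, UNCONDITIONAL**: for weights `w ≥ w₀ > 0`,
`⟨x, QGQ*x⟩ ≤ (min(w₀, κ)·(481d⁶L^{2d+4})⁻¹)⁻¹(1 + L^{−d})‖x‖²` for every `x` on `𝔅 = Λ^c ∪ Λ′` (`Q = Q″Q_j`, `G = Δ_a⁻¹` of (2.95),
`κ = c²/(η^dL^{2j})`) — gen 10's `ineq2147_V1_upper_of_2122` with its displayed (2.122)-hypothesis discharged by `ineq2122_V1`.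
[cite: Balaban1984PropagatorsII, p.248 (text after (2.147))] -/
theorem ineq2147_V1_upper (hw₀ : 0 < w₀) (hw0 : ∀ i, w₀ ≤ w i) (x : CSpace j Λ') :
    ⟪x, (tsV1 hc Λ' w).Q ((tsV1 hc Λ' w).G (LinearMap.adjoint (tsV1 hc Λ' w).Q x))⟫_ℝ ≤
      (min w₀ (c ^ 2 / (eta P.L j ^ P.d * ((P.L : ℝ) ^ j) ^ 2)) * (481 * (P.d : ℝ) ^ 6 * (P.L : ℝ) ^ (2 * P.d + 4))⁻¹)⁻¹ *
        (1 + ((P.L : ℝ) ^ P.d)⁻¹) * ‖x‖ ^ 2 := by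
  have hΓ : 0 < (481 * (P.d : ℝ) ^ 6 * (P.L : ℝ) ^ (2 * P.d + 4))⁻¹ := by
    have : (0 : ℝ) < P.d := by exact_mod_cast P.hd
    have : (0 : ℝ) < P.L := by exact_mod_cast P.L_pos
    positivity
  exact ineq2147_V1_upper_of_2122 hc hj Λ' hw hw₀ hw0 hΓ (fun B hB => ineq2122_V1 hj Λ' B hB) x

end TwoScale

end Literature.MathematicalPhysics.QuantumFieldTheory.Balaban1983to89.B6Ineq2122TwoScaleV1

end
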